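import Summits.ValiantsHypothesis.ValiantsHypothesis.Theses.RealTau

/-!
# Crux `RealTau.RealVnTransfer` (stmt-ValiantsHypothesis-18102) — line `realified-depth-four` (skeleton)

Crux strategist before the lead (2026-08-17).  The crux is Tavenas' with-constants transfer
(thesis 2014, Thm. 3.38 = Cor. 3.37 + Prop. 3.21 + realification): if `PER` is p-computable over
`ℂ` then every `V_n` is, in `ℝ[X]`, a sum of `k ≤ (n+2)^{C(⌊√(2n+3)⌋+1)}` products of
`m ≤ C(⌊√(2n+3)⌋+1)` polynomials with `≤ (n+2)^{C(⌊√(2n+3)⌋+1)}` monomials.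

TECHNIQUE WITH TEETH = TRANSFER from the solved sibling: the tree PROVES the constant-free twin
`Literature.Computability.AlgebraicComplexity.exists_sps_of_isProjection_perPoly` (over `ℚ`,
hypothesis `τ(PER_n) = n^{O(1)}`), and every ingredient of that proof except the `ℚ`-valued
substitution `kpSubst` is `CommSemiring`-general (`DepthReduction.exists_slp`,
`DepthReduction.SLP.exists_sum_prod`, `DepthReduction.card_le_of_degree_le`,
`card_support_aeval_le_of_isTerm`, `exists_computes_size_eq_complexity`, the `prop321_*`
arithmetic).  Realification `PER ∈ VP_ℂ ⇒ PER ∈ VP_ℝ` is PROVED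
(`SymmetroidDescartes.isPComputable_perPoly_real_of_complex`, item 18106 closed), so the whole
argument is re-run over `ℝ` with the WITH-CONSTANTS measure `complexity`, and no real-part
expansion of complex products is needed.

Stubs (registered):
* `stub_realEngine` — Prop. 3.21 WITH CONSTANTS over `ℝ` for ARBITRARY families (the
  strengthened, `VH`-free, non-vacuous form of the crux's engine): multilinear
  `h_n ∈ ℝ[x_0..x_{d-1}, z_0..z_{r-1}]` (`r ≤ d ≤ (n+2)^{e₁}`) of complexity `≤ (n+2)^{e₂}` become,
  under ANY substitution of terms `c X^e` for the variables, ΣΠ-sparse expressions of Tavenas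
  size.  Load-bearing; size M/L (verbatim port of the `ℚ` proof).
* `stub_realLiftData` — Cor. 3.37's data base-changed to `ℝ` with a complexity bound: under
  `PER ∈ VP_ℝ`, the bit polynomial `h_n` of `V_n`, mapped to `ℝ`, has `L_ℝ(h_n) ≤ (n+2)^e`
  (projections with rational constants are FREE for `complexity` — the one point where
  "with constants" matters), stays multilinear, and still substitutes to `V_n`.  Size S/M.
Compositions (kernel-checked, no sorry outside the stubs): `RealVnTransfer_of` (explicit
hypotheses = the two stub statements, then realification + `d = r = 2n+3`, `e₁ = 2`) and
`RealVnTransfer_of_line : RealVnTransfer` (the two stubs applied by name).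
-/

noncomputable section

-- single-conjunct layout: Sub = Summit, duplicated namespace component intended
set_option linter.dupNamespace false

namespace Summit.ValiantsHypothesis.ValiantsHypothesis.Cruxes.RealVnTransfer.RealifiedDepthFour

open MvPolynomial Literature.Computability.AlgebraicComplexity

/-! ### The two registered stubs -/

/-- **ENGINE — Tavenas' Prop. 3.21 with constants, over `ℝ`, for arbitrary families** (thesis
2014, proof of Prop. 3.21 p. 47 with `L_ℝ` in place of `τ`; Thm. 2.16 = the tree's
`DepthReduction.SLP.exists_sum_prod`): if `h_n ∈ ℝ[x_0..x_{d(n)-1}, z_0..z_{r(n)-1}]` is multilinear,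
`r(n) ≤ d(n) ≤ (n+2)^{e₁}`, `L_ℝ(h_n) ≤ (n+2)^{e₂}`, and `f_n = h_n(v_n)` for a substitution `v_n`
of TERMS `c X^e`, then `f_n = ∑_{i<k} ∏_{j<m} g_{ij}` in `ℝ[X]` with
`k, t ≤ (n+2)^{C(⌊√d(n)⌋+1)}`, `m ≤ C(⌊√d(n)⌋+1)`, every `g_{ij}` `t`-sparse.  Port of
`exists_sps_of_isProjection_perPoly` (replace its step `hsle` by the hypothesis and
`isTerm_kpSubst` by `hv`). [cite: Tavenas2014, Prop. 3.21 and Thm. 2.16] -/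
theorem stub_realEngine :
    ∀ (f : ℕ → Polynomial ℝ) (d r : ℕ → ℕ) (e₁ e₂ : ℕ),
      (∀ n, d n ≤ (n + 2) ^ e₁) → (∀ n, r n ≤ d n) →
      ∀ v : ∀ n, Fin (d n) ⊕ Fin (r n) → Polynomial ℝ, (∀ n x, IsTerm (v n x)) →
      (∀ n, ∃ h : MvPolynomial (Fin (d n) ⊕ Fin (r n)) ℝ,
        complexity h ≤ (n + 2) ^ e₂ ∧ (∀ m ∈ h.support, ∀ x, m x ≤ 1) ∧
          MvPolynomial.aeval (v n) h = f n) →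
      ∃ C : ℕ, ∀ n, ∃ (k m t : ℕ) (g : Fin k → Fin m → Polynomial ℝ),
        k ≤ (n + 2) ^ (C * (Nat.sqrt (d n) + 1)) ∧
        m ≤ C * (Nat.sqrt (d n) + 1) ∧
        t ≤ (n + 2) ^ (C * (Nat.sqrt (d n) + 1)) ∧
        (∀ i j, (g i j).support.card ≤ t) ∧
        (∑ i, ∏ j, g i j) = f n := by
  sorry

/-- **LIFT DATA — Cor. 3.37 over `ℝ` with a complexity bound** (thesis 2014, Cor. 3.37 p. 54 and
the first lines of the proof of Prop. 3.21: "`D_n` est une projection de `C_{q(n)}`"): if `PER` is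
p-computable over `ℝ` then for some `e` and every `n` there is a multilinear
`H_n ∈ ℝ[x_0..x_{2n+2}, z_0..z_{2n+2}]` with `L_ℝ(H_n) ≤ (n+2)^e` and
`H_n(X^{2^j}; 2^{2^i}) = V_n` in `ℝ[X]` — namely `H_n = h_n ⊗ ℝ` for the tree's
`Tavenas2014_cor_3_37_holds` (`isProjection_map`, `map_perPoly`,
`IsProjection.complexity_le_holds`, `IsPBounded.comp_holds`, `support_map_subset`, and the
substitution identity mapped along `ℚ → ℝ`). [cite: Tavenas2014, Cor. 3.37; Burgisser2000, Rem. 2.7] -/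
theorem stub_realLiftData :
    IsPComputable (fun n => perPoly (Fin n) ℝ) →
      ∃ e : ℕ, ∀ n, ∃ H : MvPolynomial (Fin (2 * n + 3) ⊕ Fin (2 * n + 3)) ℝ,
        complexity H ≤ (n + 2) ^ e ∧ (∀ m ∈ H.support, ∀ x, m x ≤ 1) ∧
          MvPolynomial.aeval
              (fun x => (kpSubst (2 * n + 3) (2 * n + 3) x).map (algebraMap ℚ ℝ)) H =
            (tavenasV n).map (Int.castRingHom ℝ) := by
  sorry

/-! ### Compositions (kernel-checked, no sorry) -/

/-- Every value of the realified substitution (3.1), `x_j ↦ X^{2^j}`, `z_i ↦ 2^{2^i}`, is a term.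
[folklore] -/
theorem isTerm_map_kpSubst (d r : ℕ) (x : Fin d ⊕ Fin r) :
    IsTerm ((kpSubst d r x).map (algebraMap ℚ ℝ)) := by
  rcases x with j | i
  · simp only [kpSubst, Sum.elim_inl, Polynomial.map_pow, Polynomial.map_X]
    exact isTerm_X_pow _
  · simp only [kpSubst, Sum.elim_inr, Polynomial.map_C]
    exact isTerm_C _

/-- **LIFT DATA → ENGINE → `RealVnTransfer`** (hypotheses verbatim the two stub statements):
realify the hypothesis (`isPComputable_perPoly_real_of_complex`, PROVED), take the lifted data,
and run the engine with `f_n = V_n`, `d = r = 2n + 3 ≤ (n+2)²`, `v_n` the realified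
substitution (3.1). -/
theorem RealVnTransfer_of
    (hlift : IsPComputable (fun n => perPoly (Fin n) ℝ) →
      ∃ e : ℕ, ∀ n, ∃ H : MvPolynomial (Fin (2 * n + 3) ⊕ Fin (2 * n + 3)) ℝ,
        complexity H ≤ (n + 2) ^ e ∧ (∀ m ∈ H.support, ∀ x, m x ≤ 1) ∧
          MvPolynomial.aeval
              (fun x => (kpSubst (2 * n + 3) (2 * n + 3) x).map (algebraMap ℚ ℝ)) H =
            (tavenasV n).map (Int.castRingHom ℝ))
    (heng : ∀ (f : ℕ → Polynomial ℝ) (d r : ℕ → ℕ) (e₁ e₂ : ℕ),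
      (∀ n, d n ≤ (n + 2) ^ e₁) → (∀ n, r n ≤ d n) →
      ∀ v : ∀ n, Fin (d n) ⊕ Fin (r n) → Polynomial ℝ, (∀ n x, IsTerm (v n x)) →
      (∀ n, ∃ h : MvPolynomial (Fin (d n) ⊕ Fin (r n)) ℝ,
        complexity h ≤ (n + 2) ^ e₂ ∧ (∀ m ∈ h.support, ∀ x, m x ≤ 1) ∧
          MvPolynomial.aeval (v n) h = f n) →
      ∃ C : ℕ, ∀ n, ∃ (k m t : ℕ) (g : Fin k → Fin m → Polynomial ℝ),
        k ≤ (n + 2) ^ (C * (Nat.sqrt (d n) + 1)) ∧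
        m ≤ C * (Nat.sqrt (d n) + 1) ∧
        t ≤ (n + 2) ^ (C * (Nat.sqrt (d n) + 1)) ∧
        (∀ i j, (g i j).support.card ≤ t) ∧
        (∑ i, ∏ j, g i j) = f n) :
    Summit.ValiantsHypothesis.ValiantsHypothesis.Theses.RealTau.RealVnTransfer := by
  intro hP
  -- realification (PROVED in tree, item 18106)
  have hR : IsPComputable (fun n => perPoly (Fin n) ℝ) :=
    Summit.ValiantsHypothesis.ValiantsHypothesis.Theorems.SymmetroidDescartes.isPComputable_perPoly_real_of_complex
      hP
  -- the lifted data
  obtain ⟨e, He⟩ := hlift hR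
  -- the engine with `d = r = 2n + 3`, `e₁ = 2`
  have hd : ∀ n : ℕ, 2 * n + 3 ≤ (n + 2) ^ 2 := fun n => by rw [pow_two]; nlinarith
  obtain ⟨C, hC⟩ := heng (fun n => (tavenasV n).map (Int.castRingHom ℝ)) (fun n => 2 * n + 3)
    (fun n => 2 * n + 3) 2 e hd (fun n => le_rfl)
    (fun n x => (kpSubst (2 * n + 3) (2 * n + 3) x).map (algebraMap ℚ ℝ))
    (fun n x => isTerm_map_kpSubst _ _ x) He
  exact ⟨C, hC⟩

/-- **The line: the crux from the two registered stubs, applied by name.** -/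
theorem RealVnTransfer_of_line :
    Summit.ValiantsHypothesis.ValiantsHypothesis.Theses.RealTau.RealVnTransfer :=
  RealVnTransfer_of stub_realLiftData stub_realEngine

end Summit.ValiantsHypothesis.ValiantsHypothesis.Cruxes.RealVnTransfer.RealifiedDepthFour

end
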